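import Summits.QuantumFields.YangMills.Theorems.BalabanUVNodesN15PerCubeGreenAveragingLetterKnitRow
import Summits.QuantumFields.YangMills.Theorems.BalabanUVNodesN15TwoSpacingGluingCurvedKnitCovariantLandauKnitCap
import HarnessLib

/-!
# N15 = NE2, road (c) — PROGRAMME (PC), (PC-F) «the per-cube KNIT», IV — ASSEMBLY: THE GLUED PROPAGATOR OF BAŁABAN's FULLY COVARIANT OPERATOR `Δ_{R_U} + a·Q*(U)Q(U) − D_U(I − R(U))D*_U`
# DECAYS AND INVERTS FOR `U` IN THE PER-CUBE REGULARITY CLASS (3.35) — NO displayed perturbation rows (dag-n15-c g30, n15-c∕319)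

Cell `pub-ymgap`, seat `pub-ymgap-dag-n15-c` (generation g30; R134 (a), s1; HUMAN RULING D-0062).  `bears_on: R4∕N15 · K3⁸ SpineGivenEndpointR13SepCoPHV (stmt-QuantumFields-27366)`;
filed `--kind proof --supports stmt-QuantumFields-27366 --as helper` — COUNT-NEUTRAL.  ONE theorem, 0 `def`, 0 `sorry`; an assembly of LANDED theorems, no new estimate.  Imports BY NAME
n15-c∕318 `…PerCubeGreenAveragingLetterKnitRow` (★★★ `hasMaj_sandwich_cvNVq_cvGauge_cut`, `nbhdBox_subset_localityBox`; through it n15-c∕315 ★★★★ `hasMaj_cvNVr_cvGauge_cut`) and n15-c∕316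
`…CovariantLandauKnitCap` (★★★ `cvP_cvGlued_spec_class335_cap`; through it n15-c∕203 `cvChiNbhd`, n15-c∕127 `chiCube_cut_ne_zero_nbhd`).  Nothing in the tree is modified.

WHY — THE END OF (PC-F) (HOME HANDOFF §g29 RECIPE (4)).  The per-cube programme (PC) (n15-c∕260–318, g26–g30) rebuilt [Balaban1985BackgroundPropagators] Sect. C's analytic inputs for
`U` in the PRINTED per-cube class (3.35) — «for an arbitrary cube □ … there exists a gauge transformation u on □ such that U^u = e^{iηA}, |A| < O(1)Mα₀(L^jη)⁻¹, |∇^η_U A| < O(1)Mα₀(L^jη)⁻²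
on □̃» (p. 396), NO global small gauge — up to the per-cube Landau letter (n15-c∕314∕315: the `R`-part row of the knit's perturbation `N_V k`) and the per-cube averaging letter
(n15-c∕318: the `Q`-part row).  THIS FILE runs the knit: n15-c∕316 `cvP_cvGlued_spec_class335_cap` (= n15-c∕203 = FILE 120 for the fully covariant summand, rate capped at the
`R`-rows' rate `δ_R`) with BOTH displayed rows `hNVcut`∕`hfarN` PRODUCED (`M_{ψ_k}`, `1 − M_{ψ_k}` cost nothing: entries `≤ 1`; the two parts add; `e^{−δ_R d} ≤ e^{−δ d}`).  What stays
displayed is NUMERIC: the (3.35) letters `ξ, C`, a species letter `r_V` above the two explicit (3.51)–(3.54) constants, the per-cube Green-function thresholds of n15-c∕315 (`≤ R₁`), and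
ONE near∕far letter `R_N` above the explicit sum «averaging constant `|a|K(2+K)B_q` + Landau constant `B_R(r_V(1+|J⊕J|) + a_K|ι|(|ι|σ²+2σ) + σ + w⁻¹ + 2e^{−δ_R w})`» with the knit's
thresholds `r_V(1+|J⊕J|) + R_N ≤ R₀`, `R_N ≤ θ₀`.

WHAT.  ★★★★ `cvP_cvGlued_spec_perCube335` — for odd `L ≥ 17`, masses `a₀, a > 0`, colour `ι`: `∃ δ ≤ δ_R, w₀, R₀, R₁, θ₀, B, B_R > 0, B_q ≥ 0` such that on every doubled torus of the
cover (`k ≥ 1`, `w = L^m ≥ w₀`), for trace-form coordinates `e` of `M_m(ℂ)` (`m ≥ 1`), EVERY `U(m)`-valued site bond field `U`, letters `ξ, C > 0`, unitary cube gauges `w_k` such that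
`U^{w_k} = e^{iηA_k}`, `‖A_k‖ < C∕ξ`, `‖η⁻¹∇^ηA_k‖ < C∕ξ²` on the locality box `c(Lw+6w−m₀,k)+[0,Lw+16w+2)^{d+1}` of EVERY cube `k` (the per-cube (3.35) datum of n15-c∕313–318),
and numeric letters `r_V, R_N` meeting the displayed inequalities: the glued operator `cvGlued` of the dressed smooth-cut cubes in the gauges `w_k` for the summand
`N_L ⊗ 1 − N_V^Q(U) − N_V^R(U) = a·Q*(U)Q(U) − D_U(I−R(U))D*_U` is `≤ B·e^{−(δ∕16)|y−y′|_T}` blockwise AND the two-sided inverse of `Δ_{R_U} + a·Q*(U)Q(U) − D_U(I−R(U))D*_U`.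

HONEST FRAMING ∕ LIMITS.  Assembly on MODEL carriers: doubled-torus cover `2L·L^m`, one averaging level, uniform weights in `Δ′_a`, one-level staircases, `Q(U)` = main term (125) of
[Balaban1985Averaging] (124), component-blind site gauges read at the bond's base point, crude constants; the per-cube gauges and potentials are a DATUM (the print's ∃ in (3.35) is the
caller's — produced from `Reg335Cube` by lit-balaban r06∕dag-n15-w2 elsewhere in the lane); the thresholds are displayed inequalities whose joint satisfiability uniformly in `k` is NOT
asserted here (LOCATED next: `K_k ≤ e^{(d+2)c} − 1`, `σ_k ≤ e^{(d+1)r_V} − 1`, `a_K ≤ a_K^max` are k-uniform — a numerics file).  NOT [Balaban1985BackgroundPropagators] Thm 3.1∕3.3 AS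
PRINTED (model operator ∕ class ∕ carriers); NE2⁺ NOT PRINTED, NOT proved; N15 of record untouched (DISCHARGED AS CONSUMED, p687738) — no re-pin, nothing re-claimed; K3⁸ OPEN; counts UNMOVED
(typed 28∕28); one finite 𝕋⁴ at fixed ε per index — NOT infinite volume, NOT OS on ℝ⁴, NOT a mass gap, NOT Clay.  Restate-immune (no Theses import).
-/

noncomputable section

open scoped BigOperators Matrix Matrix.Norms.L2Operator

namespace Summit.QuantumFields.YangMills.BalabanUVNodes.N15.Gluing

open Real
open Literature.MathematicalPhysics.QuantumFieldTheory.Balaban1983to89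
open Literature.MathematicalPhysics.QuantumFieldTheory.Balaban1983to89.B5Prop11Plancherel (Tor fine unitVec)
open Literature.MathematicalPhysics.QuantumFieldTheory.Balaban1983to89.B11SectG (BlockNorm HasMaj)
open Literature.MathematicalPhysics.QuantumFieldTheory.Balaban1983to89.B6Prop26Gluing (mulOp mulOp_apply)
open Literature.MathematicalPhysics.QuantumFieldTheory.Balaban1983to89.B6UnitTorusCarrier (unitTorusGeo unitTorusGeo_dist_nonneg)
open Literature.MathematicalPhysics.QuantumFieldTheory.Balaban1983to89.B9Eq3117Current (gaugeTr)
open Literature.MathematicalPhysics.QuantumFieldTheory.Balaban1983to89.B9Eq39Adjoint (covD fluct)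
open Literature.MathematicalPhysics.QuantumFieldTheory.King1986 (aK aK_pos)
open Literature.MathematicalPhysics.QuantumFieldTheory.King1986.Torus (blockOf)
open Literature.Barriers.QuantumFields (traceForm)
open Summit.QuantumFields.YangMills.BalabanUVNodes.N15.BackgroundLayer (covLapM)
open Summit.QuantumFields.YangMills.BalabanUVNodes.N15.VectorPiece (bshiftEquiv bshiftEquiv_apply bshiftEquiv_symm_apply)
open Summit.QuantumFields.YangMills.BalabanUVNodes.N15.MatrixSpecies (coordMat basisConst liftBlk)
open Summit.QuantumFields.YangMills.BalabanUVNodes.N15.TwoGrid (cubeBlocks chiCube abs_chiCube_le_one)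
open Summit.QuantumFields.YangMills.BalabanUVNodes.N15.CurvedSpecies (gaugePair)

variable {d : ℕ} {L : ℕ} [NeZero L]

set_option maxHeartbeats 800000 in
/-- ★★★★ **THE KNIT OF BAŁABAN's FULLY COVARIANT OPERATOR IN PER-CUBE GAUGES (3.35), NO DISPLAYED PERTURBATION ROWS.**  For odd `L ≥ 17`, `a₀, a > 0`, colour `ι`:
`∃ δ ≤ δ_R, w₀, R₀, R₁, θ₀, B, B_R > 0, B_q ≥ 0` such that on every doubled torus of the cover (`k ≥ 1`, `L^m ≥ w₀`), for trace-form-orthonormal `e`, EVERY unitary site field `U`,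
(3.35) letters `ξ, C > 0`, unitary cube gauges `w_k` with potentials on the locality boxes `c(Lw+6w−m₀,k)+[0,Lw+16w+2)^{d+1}` (`U^{w_k} = e^{iηA_k}`, `‖A_k‖ < C∕ξ`, `‖η⁻¹∇^ηA_k‖ < C∕ξ²`),
and numeric letters `r_V ≥` the two (3.51)–(3.54) constants, `R_N ≥` «averaging + Landau constant», with n15-c∕315's thresholds `≤ R₁` and the knit's `r_V(1+|J⊕J|) + R_N ≤ R₀`,
`R_N ≤ θ₀`: the glued operator of the dressed smooth-cut cubes in the gauges `w_k` is `≤ B·e^{−(δ∕16)d}` blockwise AND the two-sided inverse of `Δ_{R_U} + a·Q*(U)Q(U) − D_U(I−R(U))D*_U`.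
MODEL (cover, one averaging level, main term (125), crude constants); NOT [B9] Thm 3.1∕3.3 as printed.
[cite: Balaban1985BackgroundPropagators, (3.35) p.396, Thm 3.1 p.397 and Thm 3.3 p.399 (shape: «for U satisfying (3.35)»), (3.26) p.395, (3.49) p.399, (3.59)–(3.65) pp.402–403, Cor. 3.8 p.410; Balaban1984PropagatorsII, (2.91)–(2.93) p.239; Balaban1985Averaging, (125)–(126) p.36] -/
theorem cvP_cvGlued_spec_perCube335 (hL : Odd L ∧ 1 < L) (hL17 : 17 ≤ L) {a₀ : ℝ} (ha₀ : 0 < a₀) {a : ℝ} (ha : 0 < a) (ι : Type) [Fintype ι] [DecidableEq ι] :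
    ∃ δ δR w₀ R₀ R₁ θ₀ B BR Bq : ℝ, 0 < δ ∧ δ ≤ δR ∧ 0 < R₀ ∧ 0 < R₁ ∧ 0 < θ₀ ∧ 0 < B ∧ 0 < BR ∧ 0 ≤ Bq ∧
      ∀ (mv kk : ℕ), 1 ≤ kk → w₀ ≤ ((L ^ mv : ℕ) : ℝ) →
      ∀ {mm : Type} [Fintype mm] [DecidableEq mm] [Nonempty mm] (e : Matrix mm mm ℂ ≃L[ℝ] (ι → ℝ)), (∀ A B : Matrix mm mm ℂ, traceForm A B = e A ⬝ᵥ e B) →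
      ∀ (U : Fin (d + 1) → ScX d L mv kk hL → (Matrix mm mm ℂ)ˣ), (∀ μ x, (U μ x : Matrix mm mm ℂ) ∈ Matrix.unitaryGroup mm ℂ) →
      ∀ (ξ C : ℝ), 0 < ξ → 0 < C →
      ∀ (w : (Fin (d + 1) → ZMod (2 * L)) → ScX d L mv kk hL → (Matrix mm mm ℂ)ˣ), (∀ k x, (w k x : Matrix mm mm ℂ) ∈ Matrix.unitaryGroup mm ℂ) →
        (∀ k : Fin (d + 1) → ZMod (2 * L), ∃ A : Fin (d + 1) → ScX d L mv kk hL → Matrix mm mm ℂ,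
          (∀ μ, ∀ z ∈ {x : ScX d L mv kk hL | blockOf (L ^ kk) (cvM d L mv kk hL) x ∈ cubeBlocks (cvM d L mv kk hL) (coverCorner (cvM d L mv kk hL) (L ^ mv) L (L * L ^ mv + 6 * L ^ mv - coverMargin L mv) k) (L * L ^ mv + 16 * L ^ mv + 2)}, gaugeTr (scShift d L mv kk hL) (w k) U μ z = fluct (((((L ^ kk : ℕ) : ℝ))⁻¹)) A μ z) ∧
          (∀ μ, ∀ z ∈ {x : ScX d L mv kk hL | blockOf (L ^ kk) (cvM d L mv kk hL) x ∈ cubeBlocks (cvM d L mv kk hL) (coverCorner (cvM d L mv kk hL) (L ^ mv) L (L * L ^ mv + 6 * L ^ mv - coverMargin L mv) k) (L * L ^ mv + 16 * L ^ mv + 2)}, ‖A μ z‖ < C * ξ⁻¹) ∧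
          (∀ μ ν, ∀ z ∈ {x : ScX d L mv kk hL | blockOf (L ^ kk) (cvM d L mv kk hL) x ∈ cubeBlocks (cvM d L mv kk hL) (coverCorner (cvM d L mv kk hL) (L ^ mv) L (L * L ^ mv + 6 * L ^ mv - coverMargin L mv) k) (L * L ^ mv + 16 * L ^ mv + 2)}, ‖((↑(((((L ^ kk : ℕ) : ℝ))⁻¹)) : ℂ)⁻¹) • covD (scShift d L mv kk hL) (fun _ _ => (1 : (Matrix mm mm ℂ)ˣ)) μ (A ν) z‖ < C * (ξ ^ 2)⁻¹)) →
      ∀ (rV RN : ℝ), 0 ≤ rV →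
        Fintype.card ι * (@basisConst ι _ (Matrix mm mm ℂ) Matrix.frobeniusNormedAddCommGroup Matrix.frobeniusNormedSpace e * (2 * Real.sqrt (Fintype.card mm)) * (Real.sqrt (Fintype.card mm) * ((C / ξ) * Real.exp (((((L ^ kk : ℕ) : ℝ))⁻¹) * (C / ξ))))) ≤ rV →
        Fintype.card ι * (Fintype.card (Fin (d + 1)) * (Fintype.card ι * (@basisConst ι _ (Matrix mm mm ℂ) Matrix.frobeniusNormedAddCommGroup Matrix.frobeniusNormedSpace e * (2 * Real.sqrt (Fintype.card mm)) * (Real.sqrt (Fintype.card mm) * ((C / ξ) * Real.exp (((((L ^ kk : ℕ) : ℝ))⁻¹) * (C / ξ))))) ^ 2 + @basisConst ι _ (Matrix mm mm ℂ) Matrix.frobeniusNormedAddCommGroup Matrix.frobeniusNormedSpace e * (2 * Real.sqrt (Fintype.card mm)) * (Real.sqrt (Fintype.card mm) * ((C / ξ ^ 2) * Real.exp (((((L ^ kk : ℕ) : ℝ))⁻¹) * (C / ξ)))))) ≤ rV →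
        rV * (1 + Fintype.card (Fin (d + 1) ⊕ Fin (d + 1))) + a₀ * (Fintype.card ι * (Fintype.card ι * ((1 + rV * ((((L ^ kk : ℕ) : ℝ))⁻¹)) ^ ((d + 1) * L ^ kk) - 1) ^ 2 + 2 * ((1 + rV * ((((L ^ kk : ℕ) : ℝ))⁻¹)) ^ ((d + 1) * L ^ kk) - 1))) ≤ R₁ →
        ((1 + rV * ((((L ^ kk : ℕ) : ℝ))⁻¹)) ^ ((d + 1) * L ^ kk) - 1) ≤ R₁ →
        |a| * (((1 + Fintype.card ι * (@basisConst ι _ (Matrix mm mm ℂ) Matrix.frobeniusNormedAddCommGroup Matrix.frobeniusNormedSpace e * (2 * Real.sqrt (Fintype.card mm)) * (Real.sqrt (Fintype.card mm) * (((((L ^ kk : ℕ) : ℝ))⁻¹) * (C / ξ) * Real.exp (((((L ^ kk : ℕ) : ℝ))⁻¹) * (C / ξ)))))) ^ ((d + 2) * L ^ kk) - 1) * (2 + ((1 + Fintype.card ι * (@basisConst ι _ (Matrix mm mm ℂ) Matrix.frobeniusNormedAddCommGroup Matrix.frobeniusNormedSpace e * (2 * Real.sqrt (Fintype.card mm)) *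 (Real.sqrt (Fintype.card mm) * (((((L ^ kk : ℕ) : ℝ))⁻¹) * (C / ξ) * Real.exp (((((L ^ kk : ℕ) : ℝ))⁻¹) * (C / ξ)))))) ^ ((d + 2) * L ^ kk) - 1)) * Bq) + BR * (rV * (1 + Fintype.card (Fin (d + 1) ⊕ Fin (d + 1))) + aK a₀ (L : ℝ) kk * (Fintype.card ι * (Fintype.card ι * ((1 + rV * ((((L ^ kk : ℕ) : ℝ))⁻¹)) ^ ((d + 1) * L ^ kk) - 1) ^ 2 + 2 * ((1 + rV * ((((L ^ kk : ℕ) : ℝ))⁻¹)) ^ ((d + 1) * L ^ kk) - 1))) + ((1 + rV * ((((L ^ kk : ℕ) : ℝ))⁻¹)) ^ ((d + 1) * L ^ kk) - 1) + (((L ^ mv : ℕ) : ℝ))⁻¹ + 2 * Real.exp (-(δR * ((L ^ mv : ℕ) : ℝ)))) ≤ RN →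
        rV * (1 + Fintype.card (Fin (d + 1) ⊕ Fin (d + 1))) + RN ≤ R₀ → RN ≤ θ₀ →
        HasMaj (CvNorm d L mv kk hL ι) (CvNorm d L mv kk hL ι) (cvGlued d L mv kk hL a ((((L ^ kk : ℕ) : ℝ))⁻¹) ι e (fun k (p : CvX d L mv kk hL) => (w k p.1 : Matrix mm mm ℂ)) (fun μ x => (U μ x.1 : Matrix mm mm ℂ)) (cvNL d L mv kk hL a ι - cvNVq d L mv kk hL a ι e (fun μ x => (U μ x.1 : Matrix mm mm ℂ)) - cvNVr d L mv kk hL a ι e (fun μ x => (U μ x.1 : Matrix mm mm ℂ))) (fun k => (cvNVq d L mv kk hL a ι e (cvGauge d L mv kk hL (fun p => (w k p.1 : Matrix mm mm ℂ)) (fun μ x => (U μ x.1 : Matrix mm mm ℂ))) + cvNVr d L mv kk hL a ι e (cvGauge d L mv kk hL (fun p => (w k p.1 : Matrix mm mm ℂ)) (fun μ x => (U μ x.1 : Matrix mm mm ℂ))))))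
          (fun y y' => B * Real.exp (-(δ / 16 * (unitTorusGeo L kk (cvM d L mv kk hL)).dist y y'))) ∧
        (cvGlued d L mv kk hL a ((((L ^ kk : ℕ) : ℝ))⁻¹) ι e (fun k (p : CvX d L mv kk hL) => (w k p.1 : Matrix mm mm ℂ)) (fun μ x => (U μ x.1 : Matrix mm mm ℂ)) (cvNL d L mv kk hL a ι - cvNVq d L mv kk hL a ι e (fun μ x => (U μ x.1 : Matrix mm mm ℂ)) - cvNVr d L mv kk hL a ι e (fun μ x => (U μ x.1 : Matrix mm mm ℂ))) (fun k => (cvNVq d L mv kk hL a ι e (cvGauge d L mv kk hL (fun p => (w k p.1 : Matrix mm mm ℂ)) (fun μ x => (U μ x.1 : Matrix mm mm ℂ))) + cvNVr d L mv kk hL a ι e (cvGauge d L mv kk hL (fun p => (w k p.1 : Matrix mm mm ℂ)) (fun μ x => (U μ x.1 : Matrix mm mm ℂ))))) ∘ₗ (covLapM (bshiftEquiv (cvM d L mv kk hL) (L ^ kk)) ((((L ^ kk : ℕ) : ℝ))⁻¹) (gaugePair (bshiftEquiv (cvM d L mv kk hL) (L ^ kk)) (fun μ x => coordMat e (ContinuousLinearMap.mulLeftRight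 ℝ (Matrix mm mm ℂ) ((U μ x.1 : Matrix mm mm ℂ)) ((U μ x.1 : Matrix mm mm ℂ))ᴴ))) + (cvNL d L mv kk hL a ι - cvNVq d L mv kk hL a ι e (fun μ x => (U μ x.1 : Matrix mm mm ℂ)) - cvNVr d L mv kk hL a ι e (fun μ x => (U μ x.1 : Matrix mm mm ℂ)))) = LinearMap.id ∧
          (covLapM (bshiftEquiv (cvM d L mv kk hL) (L ^ kk)) ((((L ^ kk : ℕ) : ℝ))⁻¹) (gaugePair (bshiftEquiv (cvM d L mv kk hL) (L ^ kk)) (fun μ x => coordMat e (ContinuousLinearMap.mulLeftRight ℝ (Matrix mm mm ℂ) ((U μ x.1 : Matrix mm mm ℂ)) ((U μ x.1 : Matrix mm mm ℂ))ᴴ))) + (cvNL d L mv kk hL a ι - cvNVq d L mv kk hL a ι e (fun μ x => (U μ x.1 : Matrix mm mm ℂ)) - cvNVr d L mv kk hL a ι e (fun μ x => (U μ x.1 : Matrix mm mm ℂ)))) ∘ₗ cvGlued d L mv kk hL a ((((L ^ kk : ℕ) : ℝ))⁻¹) ι e (fun k (p : CvX d L mv kk hL) => (w k p.1 : Matrix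 mm mm ℂ)) (fun μ x => (U μ x.1 : Matrix mm mm ℂ)) (cvNL d L mv kk hL a ι - cvNVq d L mv kk hL a ι e (fun μ x => (U μ x.1 : Matrix mm mm ℂ)) - cvNVr d L mv kk hL a ι e (fun μ x => (U μ x.1 : Matrix mm mm ℂ))) (fun k => (cvNVq d L mv kk hL a ι e (cvGauge d L mv kk hL (fun p => (w k p.1 : Matrix mm mm ℂ)) (fun μ x => (U μ x.1 : Matrix mm mm ℂ))) + cvNVr d L mv kk hL a ι e (cvGauge d L mv kk hL (fun p => (w k p.1 : Matrix mm mm ℂ)) (fun μ x => (U μ x.1 : Matrix mm mm ℂ))))) = LinearMap.id) := by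
  classical
  have hL7 : 7 ≤ L := by omega
  have hL1r : (1 : ℝ) < (L : ℝ) := by exact_mod_cast hL.2
  -- the `R`-part per cube at its own rate `δR` (n15-c∕315), then the capped knit (n15-c∕316) at `δ ≤ δR`
  obtain ⟨δR, w₁, R₁, BR, hδR, hR₁, hBR, HR⟩ := hasMaj_cvNVr_cvGauge_cut (d := d) hL hL17 ha₀ ι ha
  obtain ⟨δ, w₀, R₀, θ₀, B, hδ, hδle, hR₀, hθ₀, hB, HK⟩ := cvP_cvGlued_spec_class335_cap (d := d) hL hL7 ha ι hδR
  refine ⟨δ, δR, max w₀ (max w₁ 2), R₀, R₁, θ₀, B, BR, B4Sect5Proof.latticeConst (d + 1) δ * Real.exp (3 * δ), hδ, hδle, hR₀, hR₁, hθ₀, hB, hBR,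
    mul_nonneg (B4Sect5Proof.latticeConst_nonneg (d + 1) hδ.le) (Real.exp_nonneg _), fun mv kk hk hw => ?_⟩
  intro mm _ _ _ e he U hU ξ C hξ hC w hwU hdat rV RN hrV hrA hrC hRle hσV hQR hRle' hθle
  have hw0 : w₀ ≤ ((L ^ mv : ℕ) : ℝ) := (le_max_left _ _).trans hw
  have hw1 : w₁ ≤ ((L ^ mv : ℕ) : ℝ) := ((le_max_left _ _).trans (le_max_right _ _)).trans hw
  have hW2 : 2 ≤ L ^ mv := by
    have h2 : (2 : ℝ) ≤ ((L ^ mv : ℕ) : ℝ) := ((le_max_right _ _).trans (le_max_right _ _)).trans hw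
    exact_mod_cast h2
  have hnr : (0 : ℝ) < ((L ^ kk : ℕ) : ℝ) := by exact_mod_cast Nat.pos_of_ne_zero (NeZero.ne _)
  have hη : (0 : ℝ) < ((((L ^ kk : ℕ) : ℝ))⁻¹) := inv_pos.mpr hnr
  have hdist0 : ∀ y y' : Tor (cvM d L mv kk hL), 0 ≤ (unitTorusGeo L kk (cvM d L mv kk hL)).dist y y' := fun y y' => unitTorusGeo_dist_nonneg L kk _ y y'
  -- signs of the letters
  have hσ0 : 0 ≤ ((1 + rV * ((((L ^ kk : ℕ) : ℝ))⁻¹)) ^ ((d + 1) * L ^ kk) - 1) := by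
    have := one_le_pow₀ (M₀ := ℝ) (a := 1 + rV * ((((L ^ kk : ℕ) : ℝ))⁻¹)) (le_add_of_nonneg_right (by positivity)) (n := (d + 1) * L ^ kk); linarith only [this]
  have hK0 : 0 ≤ ((1 + Fintype.card ι * (@basisConst ι _ (Matrix mm mm ℂ) Matrix.frobeniusNormedAddCommGroup Matrix.frobeniusNormedSpace e * (2 * Real.sqrt (Fintype.card mm)) * (Real.sqrt (Fintype.card mm) * (((((L ^ kk : ℕ) : ℝ))⁻¹) * (C / ξ) * Real.exp (((((L ^ kk : ℕ) : ℝ))⁻¹) * (C / ξ)))))) ^ ((d + 2) * L ^ kk) - 1) := by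
    have hkk := @MatrixSpecies.basisConst_nonneg ι _ (Matrix mm mm ℂ) Matrix.frobeniusNormedAddCommGroup Matrix.frobeniusNormedSpace e
    have hCξ : 0 ≤ C / ξ := div_nonneg hC.le hξ.le
    have := one_le_pow₀ (M₀ := ℝ) (a := 1 + Fintype.card ι * (@basisConst ι _ (Matrix mm mm ℂ) Matrix.frobeniusNormedAddCommGroup Matrix.frobeniusNormedSpace e * (2 * Real.sqrt (Fintype.card mm)) * (Real.sqrt (Fintype.card mm) * (((((L ^ kk : ℕ) : ℝ))⁻¹) * (C / ξ) * Real.exp (((((L ^ kk : ℕ) : ℝ))⁻¹) * (C / ξ)))))) (le_add_of_nonneg_right (by positivity)) (n := (d + 2) * L ^ kk); linarith only [this]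
  have haK : 0 < aK a₀ (L : ℝ) kk := aK_pos ha₀ hL1r hk
  have hQc0 : 0 ≤ |a| * (((1 + Fintype.card ι * (@basisConst ι _ (Matrix mm mm ℂ) Matrix.frobeniusNormedAddCommGroup Matrix.frobeniusNormedSpace e * (2 * Real.sqrt (Fintype.card mm)) * (Real.sqrt (Fintype.card mm) * (((((L ^ kk : ℕ) : ℝ))⁻¹) * (C / ξ) * Real.exp (((((L ^ kk : ℕ) : ℝ))⁻¹) * (C / ξ)))))) ^ ((d + 2) * L ^ kk) - 1) * (2 + ((1 + Fintype.card ι * (@basisConst ι _ (Matrix mm mm ℂ) Matrix.frobeniusNormedAddCommGroup Matrix.frobeniusNormedSpace e * (2 * Real.sqrt (Fintype.card mm)) * (Real.sqrt (Fintype.card mm) * (((((L ^ kk : ℕ) : ℝ))⁻¹) * (C / ξ) * Real.exp (((((L ^ kk : ℕ) : ℝ))⁻¹) * (C / ξ)))))) ^ ((d + 2) * L ^ kk) - 1)) * (B4Sect5Proof.latticeConst (d + 1) δ * Real.exp (3 * δ))) := by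
    have hc := B4Sect5Proof.latticeConst_nonneg (d + 1) hδ.le
    positivity
  have hRc0 : 0 ≤ BR * (rV * (1 + Fintype.card (Fin (d + 1) ⊕ Fin (d + 1))) + aK a₀ (L : ℝ) kk * (Fintype.card ι * (Fintype.card ι * ((1 + rV * ((((L ^ kk : ℕ) : ℝ))⁻¹)) ^ ((d + 1) * L ^ kk) - 1) ^ 2 + 2 * ((1 + rV * ((((L ^ kk : ℕ) : ℝ))⁻¹)) ^ ((d + 1) * L ^ kk) - 1))) + ((1 + rV * ((((L ^ kk : ℕ) : ℝ))⁻¹)) ^ ((d + 1) * L ^ kk) - 1) + (((L ^ mv : ℕ) : ℝ))⁻¹ + 2 * Real.exp (-(δR * ((L ^ mv : ℕ) : ℝ)))) := by positivity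
  have hRN0 : 0 ≤ RN := le_trans (add_nonneg hQc0 hRc0) hQR
  -- the per-cube potentials, chosen once
  obtain ⟨Af, hAf⟩ : ∃ Af : (Fin (d + 1) → ZMod (2 * L)) → Fin (d + 1) → ScX d L mv kk hL → Matrix mm mm ℂ, ∀ k,
      (∀ μ, ∀ z ∈ {x : ScX d L mv kk hL | blockOf (L ^ kk) (cvM d L mv kk hL) x ∈ cubeBlocks (cvM d L mv kk hL) (coverCorner (cvM d L mv kk hL) (L ^ mv) L (L * L ^ mv + 6 * L ^ mv - coverMargin L mv) k) (L * L ^ mv + 16 * L ^ mv + 2)}, gaugeTr (scShift d L mv kk hL) (w k) U μ z = fluct (((((L ^ kk : ℕ) : ℝ))⁻¹)) (Af k) μ z) ∧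
      (∀ μ, ∀ z ∈ {x : ScX d L mv kk hL | blockOf (L ^ kk) (cvM d L mv kk hL) x ∈ cubeBlocks (cvM d L mv kk hL) (coverCorner (cvM d L mv kk hL) (L ^ mv) L (L * L ^ mv + 6 * L ^ mv - coverMargin L mv) k) (L * L ^ mv + 16 * L ^ mv + 2)}, ‖Af k μ z‖ < C * ξ⁻¹) ∧
      (∀ μ ν, ∀ z ∈ {x : ScX d L mv kk hL | blockOf (L ^ kk) (cvM d L mv kk hL) x ∈ cubeBlocks (cvM d L mv kk hL) (coverCorner (cvM d L mv kk hL) (L ^ mv) L (L * L ^ mv + 6 * L ^ mv - coverMargin L mv) k) (L * L ^ mv + 16 * L ^ mv + 2)}, ‖((↑(((((L ^ kk : ℕ) : ℝ))⁻¹)) : ℂ)⁻¹) • covD (scShift d L mv kk hL) (fun _ _ => (1 : (Matrix mm mm ℂ)ˣ)) μ (Af k ν) z‖ < C * (ξ ^ 2)⁻¹) :=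
    ⟨fun k => (hdat k).choose, fun k => (hdat k).choose_spec⟩
  -- the one-step neighbourhood of the cut box lies in the locality box
  have hbig : ∀ (k : Fin (d + 1) → ZMod (2 * L)) (z : CvX d L mv kk hL), z ∈ cvChiNbhd d L mv kk hL k →
      z.1 ∈ {x : ScX d L mv kk hL | blockOf (L ^ kk) (cvM d L mv kk hL) x ∈ cubeBlocks (cvM d L mv kk hL) (coverCorner (cvM d L mv kk hL) (L ^ mv) L (L * L ^ mv + 6 * L ^ mv - coverMargin L mv) k) (L * L ^ mv + 16 * L ^ mv + 2)} := by
    intro k z hz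
    rcases hz with hz | ⟨μ, hz | hz⟩
    · exact nbhdBox_subset_localityBox hL hL17 mv kk hW2 k (chiCube_cut_ne_zero_nbhd hL hL7 mv kk (L ^ kk) k z hz).1
    · have h := (chiCube_cut_ne_zero_nbhd hL hL7 mv kk (L ^ kk) k _ hz).2.1 μ
      rw [Equiv.apply_symm_apply] at h
      exact nbhdBox_subset_localityBox hL hL17 mv kk hW2 k h
    · have h := (chiCube_cut_ne_zero_nbhd hL hL7 mv kk (L ^ kk) k _ hz).2.2 μ
      rw [Equiv.symm_apply_apply] at h
      exact nbhdBox_subset_localityBox hL hL17 mv kk hW2 k h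
  -- the (3.35) datum in the knit's bond-point convention on `cvChiNbhd k`
  have hg : ∀ (k : Fin (d + 1) → ZMod (2 * L)) μ (z : CvX d L mv kk hL), z ∈ cvChiNbhd d L mv kk hL k →
      gaugeTr (bshiftEquiv (cvM d L mv kk hL) (L ^ kk)) (fun z : CvX d L mv kk hL => w k z.1) (fun μ (p : CvX d L mv kk hL) => U μ p.1) μ z =
        fluct (((((L ^ kk : ℕ) : ℝ))⁻¹)) (fun μ (z : CvX d L mv kk hL) => Af k μ z.1) μ z := fun k μ z hz =>
    (hAf k).1 μ z.1 (hbig k z hz)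
  have hAcl : ∀ (k : Fin (d + 1) → ZMod (2 * L)) μ (z : CvX d L mv kk hL), z ∈ cvChiNbhd d L mv kk hL k → ‖(fun μ (z : CvX d L mv kk hL) => Af k μ z.1) μ z‖ < C * ξ⁻¹ :=
    fun k μ z hz => (hAf k).2.1 μ z.1 (hbig k z hz)
  have hDcl : ∀ (k : Fin (d + 1) → ZMod (2 * L)) μ ν (z : CvX d L mv kk hL), z ∈ cvChiNbhd d L mv kk hL k →
      ‖(((((((L ^ kk : ℕ) : ℝ))⁻¹) : ℝ) : ℂ)⁻¹) • covD (bshiftEquiv (cvM d L mv kk hL) (L ^ kk)) (fun _ _ => (1 : (Matrix mm mm ℂ)ˣ)) μ ((fun μ (z : CvX d L mv kk hL) => Af k μ z.1) ν) z‖ < C * (ξ ^ 2)⁻¹ :=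
    fun k μ ν z hz => (hAf k).2.2 μ ν z.1 (hbig k z hz)
  -- the rows of `N_V k = (N_V^Q + N_V^R)(U^{w_k})` behind the input cut: `Q`-part n15-c∕318, `R`-part n15-c∕315
  have hQ : ∀ (k : Fin (d + 1) → ZMod (2 * L)) (f : CvX d L mv kk hL → ℝ), (∀ x, |f x| ≤ 1) →
      HasMaj (CvNorm d L mv kk hL ι) (CvNorm d L mv kk hL ι)
        (mulOp (fun p : CvX d L mv kk hL × ι => f p.1) ∘ₗ cvNVq d L mv kk hL a ι e (cvGauge d L mv kk hL (fun p : CvX d L mv kk hL => (w k p.1 : Matrix mm mm ℂ)) (fun μ (p : CvX d L mv kk hL) => (U μ p.1 : Matrix mm mm ℂ))) ∘ₗ mulOp (fun q : CvX d L mv kk hL × ι => cvChi d L mv kk hL k q.1))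
        (fun y y' => |a| * (((1 + Fintype.card ι * (@basisConst ι _ (Matrix mm mm ℂ) Matrix.frobeniusNormedAddCommGroup Matrix.frobeniusNormedSpace e * (2 * Real.sqrt (Fintype.card mm)) * (Real.sqrt (Fintype.card mm) * (((((L ^ kk : ℕ) : ℝ))⁻¹) * (C / ξ) * Real.exp (((((L ^ kk : ℕ) : ℝ))⁻¹) * (C / ξ)))))) ^ ((d + 2) * L ^ kk) - 1) * (2 + ((1 + Fintype.card ι * (@basisConst ι _ (Matrix mm mm ℂ) Matrix.frobeniusNormedAddCommGroup Matrix.frobeniusNormedSpace e * (2 * Real.sqrt (Fintype.card mm)) * (Real.sqrt (Fintype.card mm) * (((((L ^ kk : ℕ) : ℝ))⁻¹) * (C / ξ) * Real.exp (((((L ^ kk : ℕ) : ℝ))⁻¹) * (C / ξ)))))) ^ ((d + 2) * L ^ kk) - 1)) * (B4Sect5Proof.latticeConst (d + 1) δ * Real.exp (3 * δ))) * Real.exp (-(δ * (unitTorusGeo L kk (cvM d L mv kk hL)).dist y y'))) := fun k f hf =>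
    hasMaj_sandwich_cvNVq_cvGauge_cut hL hL17 mv kk hW2 ι e U hU hξ hC.le w hwU hdat a hδ k f hf
  have hR := HR mv kk hk hw1 e he U hU ξ C hξ hC w hwU hdat rV hrV hrA hrC hRle hσV
  have hRf : ∀ (k : Fin (d + 1) → ZMod (2 * L)) (f : CvX d L mv kk hL → ℝ), (∀ x, |f x| ≤ 1) →
      HasMaj (CvNorm d L mv kk hL ι) (CvNorm d L mv kk hL ι)
        (mulOp (fun p : CvX d L mv kk hL × ι => f p.1) ∘ₗ cvNVr d L mv kk hL a ι e (cvGauge d L mv kk hL (fun p : CvX d L mv kk hL => (w k p.1 : Matrix mm mm ℂ)) (fun μ (p : CvX d L mv kk hL) => (U μ p.1 : Matrix mm mm ℂ))) ∘ₗ mulOp (fun q : CvX d L mv kk hL × ι => cvChi d L mv kk hL k q.1))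
        (fun y y' => BR * (rV * (1 + Fintype.card (Fin (d + 1) ⊕ Fin (d + 1))) + aK a₀ (L : ℝ) kk * (Fintype.card ι * (Fintype.card ι * ((1 + rV * ((((L ^ kk : ℕ) : ℝ))⁻¹)) ^ ((d + 1) * L ^ kk) - 1) ^ 2 + 2 * ((1 + rV * ((((L ^ kk : ℕ) : ℝ))⁻¹)) ^ ((d + 1) * L ^ kk) - 1))) + ((1 + rV * ((((L ^ kk : ℕ) : ℝ))⁻¹)) ^ ((d + 1) * L ^ kk) - 1) + (((L ^ mv : ℕ) : ℝ))⁻¹ + 2 * Real.exp (-(δR * ((L ^ mv : ℕ) : ℝ)))) * Real.exp (-(δ * (unitTorusGeo L kk (cvM d L mv kk hL)).dist y y'))) := fun k f hf =>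
    (TwoGrid.hasMaj_mulOp_comp_of_abs_le_one (g := unitTorusGeo L kk (cvM d L mv kk hL)) (liftBlk (cvBlk d L mv kk hL) ι) (m := fun p : CvX d L mv kk hL × ι => f p.1)
      (fun p => hf p.1) (fun y y' => mul_nonneg hRc0 (Real.exp_nonneg _)) (hR k)).mono fun y y' =>
      mul_le_mul_of_nonneg_left (Real.exp_le_exp.mpr (neg_le_neg (mul_le_mul_of_nonneg_right hδle (hdist0 y y')))) hRc0
  have hrow : ∀ (k : Fin (d + 1) → ZMod (2 * L)) (f : CvX d L mv kk hL → ℝ), (∀ x, |f x| ≤ 1) →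
      HasMaj (CvNorm d L mv kk hL ι) (CvNorm d L mv kk hL ι)
        (mulOp (fun p : CvX d L mv kk hL × ι => f p.1) ∘ₗ (cvNVq d L mv kk hL a ι e (cvGauge d L mv kk hL (fun p : CvX d L mv kk hL => (w k p.1 : Matrix mm mm ℂ)) (fun μ (p : CvX d L mv kk hL) => (U μ p.1 : Matrix mm mm ℂ))) + cvNVr d L mv kk hL a ι e (cvGauge d L mv kk hL (fun p : CvX d L mv kk hL => (w k p.1 : Matrix mm mm ℂ)) (fun μ (p : CvX d L mv kk hL) => (U μ p.1 : Matrix mm mm ℂ)))) ∘ₗ mulOp (fun q : CvX d L mv kk hL × ι => cvChi d L mv kk hL k q.1))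
        (fun y y' => RN * Real.exp (-(δ * (unitTorusGeo L kk (cvM d L mv kk hL)).dist y y'))) := fun k f hf => by
    rw [LinearMap.add_comp, LinearMap.comp_add]
    exact ((hQ k f hf).add (hRf k f hf)).mono fun y y' => by
      rw [← add_mul]
      exact mul_le_mul_of_nonneg_right hQR (Real.exp_nonneg _)
  -- the cuts
  have hψ1 : ∀ (k : Fin (d + 1) → ZMod (2 * L)) (x : CvX d L mv kk hL), |cvPsi d L mv kk hL k x| ≤ 1 := fun k x => abs_chiCube_le_one _ x
  have h1ψ : ∀ (k : Fin (d + 1) → ZMod (2 * L)) (x : CvX d L mv kk hL), |(1 - cvPsi d L mv kk hL k) x| ≤ 1 := fun k x => by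
    rw [Pi.sub_apply, Pi.one_apply]; unfold cvPsi chiCube; split_ifs <;> simp
  have hid : ∀ k : Fin (d + 1) → ZMod (2 * L), (LinearMap.id - mulOp (fun p : CvX d L mv kk hL × ι => cvPsi d L mv kk hL k p.1)) =
      mulOp (fun p : CvX d L mv kk hL × ι => (1 - cvPsi d L mv kk hL k) p.1) := fun k =>
    LinearMap.ext fun f => funext fun p => by simp [mulOp_apply, sub_mul]
  exact HK mv kk hk hw0 e he w hwU (fun μ (p : CvX d L mv kk hL) => U μ p.1) (fun μ p => hU μ p.1) (fun k μ (z : CvX d L mv kk hL) => Af k μ z.1) ξ C hξ hC.le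
    hg hAcl hDcl rV RN RN hrV hRN0 hRN0 hRle' hθle hrA hrC (fun k => hrow k (cvPsi d L mv kk hL k) (hψ1 k)) (fun k => by rw [hid k]; exact hrow k (1 - cvPsi d L mv kk hL k) (h1ψ k))

end Summit.QuantumFields.YangMills.BalabanUVNodes.N15.Gluing

end
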